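import Mathlib
import Summits.NavierStokesRegularity.NavierStokesRegularity.Theorems.EulerZoomLiouvillePowerGaugeEulerLiouvilleLastExitSpikesOrHovering
import Summits.NavierStokesRegularity.NavierStokesRegularity.Theorems.EulerZoomLiouvillePowerGaugeEulerLiouvilleNeedleClockLocal
import HarnessLib

/-!
# «NO CRITICAL SPIKES» — THE EXPLICIT-CONSTANT SPIKE MEMBER (K-SPIKE; LEAD 19832 ns-typeII-p2 g14 key 2026-08-29T01:16:47Z,
# `HasResidenceClock` alternative-10 candidate; crux `EulerZoomLiouville.PowerGaugeEulerLiouville` = stmt-NavierStokesRegularity-19832;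
# width seat ns-sfl-p1 g7, `--supports stmt-NavierStokesRegularity-19832 --as helper`)

ns-ezl-w3 g6's «SPIKES OR HOVERING» member (`…LastExitSpikesOrHovering`, p682182, alternative 9) kills an exactly self-similar `C²` member with
ONE vortical point `x₀`, ONE level `h < ℋ(x₀)`, NO FAR HOVERING above `h` (`‖W‖ ≥ w₀` on far vortical points of `{ℋ > h}`) and NO VORTICAL
SPIKES `ℋ ≤ h + C R^θ` on vortical points of `{ℋ > h} ∩ B̄(0,2R)` at a SUB-critical exponent `θ < 2+ρ`.  This file runs the same last-exit
machine (LE1 `LastExit.stayersReturn`, LE2b `LastExit.lateReturnsVanish`) AT THE CRITICAL EXPONENT `θ = 2+ρ` and says where the volume race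
breaks: the spike envelope enters ONLY through LE1's return budget `C R^θ ≤ (1−2γ)w₀²·(c′/2)·R^{2+ρ}` for the clock strength `c′`, and the
needle race `NeedleRace.false_of_powerClockAt_of_strongThinExits` consumes the clock at ONE strength `c′` with `6γc′ < β`, `β` the EXPLICIT
strong-thin-exits rate of `NeedleFastSetMeasure.thinFastExits_strong`.  Hence the CLOSED threshold
`κ_sp(ρ,c,w₀) = (1−2γ)·w₀²·β₀(ρ,c)/(24γ)`, `γ = 1/(2+ρ)`, `β₀ = min 1 (γ²/(614400·(bandConst+1)·(2c_A+2c_E+2)))/4`,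
`c_A = c·2^{1−2ρ}`, `c_E = (1−ρ)c/(2+ρ)` (`bandConst` = `NeedleBandLaw.bandConst`).

* `LastExit.powerClockAt_of_criticalSpikes` — profile level: no far hovering + critical spikes with `C ≤ (1−2γ)w₀²c′/2` ⇒ the power clock AT
  strength `c′` at some ball (alt 9's proof with `θ = 2+ρ`; the `S₀` of LE2b is exponent-free);
* `Loc.selfSimilar_ae_eq_zero_of_criticalSpikesC2_profile` — THE MEMBER (centred): binder = alt 9's with `θ < 2+ρ` replaced by the critical
  exponent and `C < κ_sp(ρ,c,w₀)`; proof = `NeedleRace.selfSimilar_ae_eq_zero_of_localPowerClockC2`'s body (p676660) run at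
  `c′ = β₀/(12γ)` with the EXPLICIT `β₀`.

WHAT THIS IS NOT: not NS regularity, not the crux E — a member-level alternative on the MODEL lattice (hypothetical blow-up members); the spike
face itself (`stub_spikeFace`) stays OPEN; 19832 OPEN; no summit statement is proved here. [folklore; ConstantinIgnatovaVicol2026Putative §3.4–§3.5]
-/

noncomputable section

set_option linter.dupNamespace false

open Set Filter Topology Metric MeasureTheory Function
open scoped RealInnerProductSpace ENNReal NNReal

namespace Summit.NavierStokesRegularity.NavierStokesRegularity.Theorems.PowerGaugeEulerLiouville

open Literature.Analysis Literature.Analysis.FluidPDE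

namespace LastExit

/-- **THE POWER CLOCK AT ONE STRENGTH FROM CRITICAL SPIKES** (profile level).  `(V,P′)` a `C²` profile (`γ = 1/(2+ρ)`, `0 < ρ ≤ ½`), NO FAR
HOVERING above `h` (floor `w₀` beyond `R₁`), vortical spikes above `h` bounded AT THE CRITICAL EXPONENT, `ℋ ≤ h + C R^{2+ρ}` on vortical
points of `{ℋ > h} ∩ B̄(0,2R)` (`R ≥ 1`), with `C ≤ (1−2γ)w₀²·c′/2` for a clock strength `c′ > 0`, and one vortical `x₀` with `ℋ(x₀) > h` ⇒
the POWER CLOCK AT STRENGTH `c′` at some ball (binders of `localPowerClock_of_spikesOrHovering` with `θ := 2+ρ` and the one `c′`).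
[folklore; ConstantinIgnatovaVicol2026Putative §3.4–§3.5] -/
theorem powerClockAt_of_criticalSpikes :
    ∀ ρ : ℝ, 0 < ρ → ρ ≤ 1 / 2 →
    ∀ (V : EuclideanSpace ℝ (Fin 3) → EuclideanSpace ℝ (Fin 3)) (P' : EuclideanSpace ℝ (Fin 3) → ℝ), ContDiff ℝ 2 V →
      IsSelfSimilarEulerProfile (1 / (2 + ρ)) 0 V P' →
      ∀ (h w₀ R₁ : ℝ), 0 < w₀ →
        (∀ y : EuclideanSpace ℝ (Fin 3), R₁ ≤ ‖y‖ →
          h < selfSimilarBernoulli (1 / (2 + ρ)) 0 V P' y → curl V y ≠ 0 →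
            w₀ ≤ ‖selfSimilarTransport (1 / (2 + ρ)) 0 V y‖) →
      ∀ (C c' : ℝ), 0 < c' → C ≤ (1 - 2 * (1 / (2 + ρ))) * w₀ ^ 2 * (c' / 2) →
        (∀ R : ℝ, 1 ≤ R → ∀ z : EuclideanSpace ℝ (Fin 3), ‖z‖ ≤ 2 * R → curl V z ≠ 0 →
          h < selfSimilarBernoulli (1 / (2 + ρ)) 0 V P' z →
            selfSimilarBernoulli (1 / (2 + ρ)) 0 V P' z ≤ h + C * R ^ (2 + ρ)) →
      ∀ x₀ : EuclideanSpace ℝ (Fin 3), curl V x₀ ≠ 0 →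
        h < selfSimilarBernoulli (1 / (2 + ρ)) 0 V P' x₀ →
        ∃ x₁ : EuclideanSpace ℝ (Fin 3), ∃ r : ℝ, 0 < r ∧ ∃ R₀ : ℝ, ∀ R : ℝ, R₀ ≤ R →
          ∀ (V' : EuclideanSpace ℝ (Fin 3) → EuclideanSpace ℝ (Fin 3)) (K Rbig : ℝ), ContDiff ℝ 2 V' →
            (∀ y, ‖fderiv ℝ V' y‖ ≤ K) → 2 * R < Rbig →
            (∀ w ∈ Metric.ball (0 : EuclideanSpace ℝ (Fin 3)) Rbig, V' w = V w) →
            (volume (Metric.ball x₁ r ∩ {y | ∀ σ ∈ Set.Icc 0 (c' * R ^ (2 + ρ)),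
              ‖ODE.evolutionMap (fun _ : ℝ => selfSimilarTransport (1 / (2 + ρ)) 0 V') 0 (-σ) y‖ ≤ 2 * R})).toReal ≤
              (volume (Metric.ball x₁ r)).toReal / 2 := by
  -- adapted from the line's `member_of` (ns-idea-11 g8, `Lines/last_exit.lean`), with the stubs replaced by the tree theorems
  -- adapted from `localPowerClock_of_spikesOrHovering` (ns-ezl-w3 g6, alt 9): the envelope at the CRITICAL exponent enters only through `hD`
  intro ρ hρ hρh V P' hV hprof h w₀ R₁ hw₀ hNFH C c' hc' hC hNS x₀ hx₀ hhx₀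
  obtain ⟨r, hr, hball, hlate⟩ := lateReturnsVanish ρ hρ hρh V P' hV hprof h w₀ R₁ hw₀ hNFH x₀ hx₀ hhx₀
  obtain ⟨S₀, hS₀⟩ := hlate (1 / 2) (by norm_num)
  have hk₂ : 0 < c' / 2 := by positivity
  obtain ⟨A₂, hA₂, hth₂⟩ := rpow_threshold hk₂ (by linarith : (0 : ℝ) < 2 + ρ) S₀
  refine ⟨x₀, r, hr, A₂, fun R hR V' K Rbig hV' hK hRbig hagree => ?_⟩
  have hR₂' : A₂ ≤ R := hR
  have hR1 : 1 ≤ R := le_trans hA₂ hR₂'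
  have hRpos : 0 < R := lt_of_lt_of_le one_pos hR1
  set T : ℝ := c' * R ^ (2 + ρ) with hT
  have hTnn : 0 ≤ T := by positivity
  have hD : (h + C * R ^ (2 + ρ)) - h ≤ (1 - 2 * (1 / (2 + ρ))) * w₀ ^ 2 * (T / 2) := by
    have hRe : 0 ≤ R ^ (2 + ρ) := Real.rpow_nonneg hRpos.le _
    have h1 := mul_le_mul_of_nonneg_right hC hRe
    have e1 : (1 - 2 * (1 / (2 + ρ))) * w₀ ^ 2 * (c' / 2) * R ^ (2 + ρ) =
        (1 - 2 * (1 / (2 + ρ))) * w₀ ^ 2 * (T / 2) := by rw [hT]; ring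
    linarith [h1, e1]
  have hS : S₀ ≤ T / 2 := by
    have h0 := hth₂ R hR₂'
    rw [Real.rpow_zero, mul_one] at h0
    have e1 : c' / 2 * R ^ (2 + ρ) = T / 2 := by rw [hT]; ring
    rw [← e1]; exact h0
  -- the staying labels return late
  have hsub :
      Metric.ball x₀ r ∩ {y | ∀ σ ∈ Set.Icc 0 (c' * R ^ (2 + ρ)),
          ‖ODE.evolutionMap (fun _ : ℝ => selfSimilarTransport (1 / (2 + ρ)) 0 V') 0 (-σ) y‖ ≤ 2 * R} ⊆
      Metric.ball x₀ r ∩ {y | ∃ σ : ℝ, T / 2 ≤ σ ∧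
          (∀ σ' ∈ Set.Icc 0 σ, ‖ODE.evolutionMap (fun _ : ℝ => selfSimilarTransport (1 / (2 + ρ)) 0 V') 0 (-σ') y‖ ≤ 2 * R) ∧
          ‖ODE.evolutionMap (fun _ : ℝ => selfSimilarTransport (1 / (2 + ρ)) 0 V') 0 (-σ) y‖ < R₁} := by
    rintro y ⟨hyB, hstay⟩
    refine ⟨hyB, ?_⟩
    obtain ⟨hcy, hhy⟩ := hball hyB
    have hstay' : ∀ σ ∈ Set.Icc 0 T,
        ‖ODE.evolutionMap (fun _ : ℝ => selfSimilarTransport (1 / (2 + ρ)) 0 V') 0 (-σ) y‖ ≤ 2 * R := by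
      simpa [hT] using hstay
    obtain ⟨σ, hσ, hσR₁⟩ :=
      stayersReturn ρ hρ hρh V P' hV hprof h w₀ R₁ hw₀ hNFH R (h + C * R ^ (2 + ρ)) (T / 2)
        (fun z hz hcz hhz => hNS R hR1 z hz hcz hhz) hD (by positivity)
        V' K Rbig hV' hK hRbig hagree y T hcy hhy hstay' (T / 2) (by positivity) (by linarith)
    refine ⟨σ, hσ.1, fun σ' hσ' => hstay' σ' ⟨hσ'.1, ?_⟩, hσR₁⟩
    have : σ ≤ T / 2 + T / 2 := hσ.2
    linarith [hσ'.2]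
  -- measure bookkeeping
  have hfin : volume (Metric.ball x₀ r ∩ {y | ∃ σ : ℝ, T / 2 ≤ σ ∧
          (∀ σ' ∈ Set.Icc 0 σ, ‖ODE.evolutionMap (fun _ : ℝ => selfSimilarTransport (1 / (2 + ρ)) 0 V') 0 (-σ') y‖ ≤ 2 * R) ∧
          ‖ODE.evolutionMap (fun _ : ℝ => selfSimilarTransport (1 / (2 + ρ)) 0 V') 0 (-σ) y‖ < R₁}) ≠ ⊤ :=
    (lt_of_le_of_lt (measure_mono Set.inter_subset_left) measure_ball_lt_top).ne
  have hmono := ENNReal.toReal_mono hfin (measure_mono hsub)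
  have hhalf := hS₀ (T / 2) R hS V' K Rbig hV' hK hRbig hagree
  calc (volume (Metric.ball x₀ r ∩ {y | ∀ σ ∈ Set.Icc 0 (c' * R ^ (2 + ρ)),
          ‖ODE.evolutionMap (fun _ : ℝ => selfSimilarTransport (1 / (2 + ρ)) 0 V') 0 (-σ) y‖ ≤ 2 * R})).toReal
      ≤ _ := hmono
    _ ≤ 1 / 2 * (volume (Metric.ball x₀ r)).toReal := hhalf
    _ = (volume (Metric.ball x₀ r)).toReal / 2 := by ring

end LastExit

/-! ## The member -/

/-- **«NO CRITICAL SPIKES» MEMBER (centred).**  An exactly self-similar member of the crux class (`0 < ρ ≤ ½`, `0 ≤ c`, crux hypotheses verbatim)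
with a `C²` velocity profile such that for EVERY classical pressure `P′` there are a vortical `x₀`, a level `h < ℋ_{P′}(x₀)`, NO FAR HOVERING above
`h` with floor `w₀`, and NO VORTICAL SPIKES above `h` AT THE CRITICAL EXPONENT with a constant `C < κ_sp(ρ,c,w₀)` (closed expression in the binder),
is trivial.  [folklore; ConstantinIgnatovaVicol2026Putative §3.4–§3.5] -/
theorem Loc.selfSimilar_ae_eq_zero_of_criticalSpikesC2_profile {ρ : ℝ} (hρ : 0 < ρ) (hρ1 : ρ ≤ 1 / 2)
    {u : ℝ → EuclideanSpace ℝ (Fin 3) → EuclideanSpace ℝ (Fin 3)} {p : ℝ → EuclideanSpace ℝ (Fin 3) → ℝ}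
    {H : ℝ → EuclideanSpace ℝ (Fin 3) → EuclideanSpace ℝ (Fin 3) →L[ℝ] EuclideanSpace ℝ (Fin 3)} {c : ℝ≥0}
    (hsw : IsSuitableWeakSolutionOn (slab (EuclideanSpace ℝ (Fin 3)) (Iio 0) isOpen_Iio) 0 0 u p)
    (hH : HasWeakSpatialGradientOn (slab (EuclideanSpace ℝ (Fin 3)) (Iio 0) isOpen_Iio) u H)
    (hgauge : ∀ a : ℝ, 0 < a →
      ENNReal.ofReal (a ^ (2 * ρ)) * cknA a (0 : ℝ × EuclideanSpace ℝ (Fin 3)) u +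
          ENNReal.ofReal (a ^ ρ) * cknE a (0 : ℝ × EuclideanSpace ℝ (Fin 3)) H +
        ENNReal.ofReal (a ^ (2 * ρ)) * cknD a (0 : ℝ × EuclideanSpace ℝ (Fin 3)) p ≤ (c : ℝ≥0∞))
    {V : EuclideanSpace ℝ (Fin 3) → EuclideanSpace ℝ (Fin 3)} {P : EuclideanSpace ℝ (Fin 3) → ℝ}
    (hu : ∀ τ : ℝ, τ < 0 → u τ = selfSimilarCollapse (1 / (2 + ρ)) 0 V τ)
    (hp : ∀ τ : ℝ, τ < 0 → p τ = selfSimilarCollapsePressure (1 / (2 + ρ)) 0 P τ)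
    (hV : ContDiff ℝ 2 V)
    (hB : ∀ P' : EuclideanSpace ℝ (Fin 3) → ℝ, IsSelfSimilarEulerProfile (1 / (2 + ρ)) 0 V P' →
      ∃ x₀ : EuclideanSpace ℝ (Fin 3), curl V x₀ ≠ 0 ∧ ∃ h : ℝ, h < selfSimilarBernoulli (1 / (2 + ρ)) 0 V P' x₀ ∧
        ∃ w₀ R₁ : ℝ, 0 < w₀ ∧ (∀ y : EuclideanSpace ℝ (Fin 3), R₁ ≤ ‖y‖ →
          h < selfSimilarBernoulli (1 / (2 + ρ)) 0 V P' y → curl V y ≠ 0 →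
            w₀ ≤ ‖selfSimilarTransport (1 / (2 + ρ)) 0 V y‖) ∧
        ∃ C : ℝ, C < (1 - 2 * (1 / (2 + ρ))) * w₀ ^ 2 * (min 1 ((1 / (2 + ρ)) ^ 2 / (614400 * (NeedleBandLaw.bandConst + 1) * (2 * ((c : ℝ) * 2 ^ (1 - 2 * ρ)) + 2 * ((1 - ρ) / (2 + ρ) * (c : ℝ)) + 2))) / 4) / (24 * (1 / (2 + ρ))) ∧
          ∀ R : ℝ, 1 ≤ R → ∀ z : EuclideanSpace ℝ (Fin 3), ‖z‖ ≤ 2 * R → curl V z ≠ 0 →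
          h < selfSimilarBernoulli (1 / (2 + ρ)) 0 V P' z →
            selfSimilarBernoulli (1 / (2 + ρ)) 0 V P' z ≤ h + C * R ^ (2 + ρ)) :
    uncurry u =ᵐ[volume.restrict (Iio (0 : ℝ) ×ˢ (univ : Set (EuclideanSpace ℝ (Fin 3))))] 0 := by
  have hρ1' : ρ < 1 := by linarith
  have h2ρ : (0 : ℝ) < 2 + ρ := by linarith
  have hγ : (0 : ℝ) < 1 / (2 + ρ) := one_div_pos.2 h2ρ
  have h1ρ : 0 ≤ 1 - ρ := by linarith
  -- ### a classical pressure for the profile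
  have hA : ∀ a : ℝ, 0 < a → ENNReal.ofReal (a ^ (2 * ρ)) *
      cknA a (0 : ℝ × EuclideanSpace ℝ (Fin 3)) u ≤ (c : ℝ≥0∞) :=
    fun a ha => le_trans (le_trans le_self_add le_self_add) (hgauge a ha)
  have hD : ∀ a : ℝ, 0 < a → ENNReal.ofReal (a ^ (2 * ρ)) *
      cknD a (0 : ℝ × EuclideanSpace ℝ (Fin 3)) p ≤ (c : ℝ≥0∞) :=
    fun a ha => le_trans le_add_self (hgauge a ha)
  have hpm : AEStronglyMeasurable (uncurry p)
      (volume.restrict (Iio (0 : ℝ) ×ˢ (univ : Set (EuclideanSpace ℝ (Fin 3))))) := by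
    have := hsw.distributional.2.2.1.aestronglyMeasurable
    simpa [slab] using this
  have hPm := aestronglyMeasurable_pressureProfile hpm hp
  have hDprof := profile_pressure_weight_of_gaugeD hρ hρ1' hpm hp hD
  have hP1 : LocallyIntegrable P volume :=
    EnergySaturation.locallyIntegrable_pressure_of_weight hρ1' hPm
      (ENNReal.mul_ne_top ENNReal.ofReal_ne_top ENNReal.coe_ne_top) hDprof
  obtain ⟨P', hprof⟩ :=
    WeakToClassical.exists_isSelfSimilarEulerProfile_of_contDiff hsw.distributional hu hp hV hP1
  -- ### the data
  obtain ⟨x₀, hx₀, h, hhx₀, w₀, R₁, hw₀, hNFH, C, hCκ, hNS⟩ := hB P' hprof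
  -- ### divergence-free profile and the class budgets on closed balls (as in `…localPowerClockC2`)
  obtain ⟨hdiv, -⟩ := NeedleRace.thinFastExits_of_selfSimilarC2 hρ hρ1 hsw hH hgauge hu hp hV
  obtain ⟨hA', hE'⟩ :=
    NeedleThinCore.selfSimilar_needle_inputs hρ hρ1' hsw hH hgauge hu hp (hV.of_le one_le_two)
  have hbA : ∀ L : ℝ, 1 ≤ L →
      ∫⁻ z in closedBall (0 : EuclideanSpace ℝ (Fin 3)) L, ‖V z‖ₑ ^ 2 ≤
        ENNReal.ofReal ((c : ℝ) * 2 ^ (1 - 2 * ρ) * L ^ (1 - 2 * ρ)) := by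
    intro L hL
    have hL0 : 0 < L := by linarith
    calc ∫⁻ z in closedBall (0 : EuclideanSpace ℝ (Fin 3)) L, ‖V z‖ₑ ^ 2
        ≤ ∫⁻ z in ball (0 : EuclideanSpace ℝ (Fin 3)) (2 * L), ‖V z‖ₑ ^ 2 :=
          lintegral_mono_set (closedBall_subset_ball (by linarith))
      _ ≤ (c : ℝ≥0∞) * ENNReal.ofReal ((2 * L) ^ (1 - 2 * ρ)) := hA' (2 * L) (by linarith)
      _ = ENNReal.ofReal ((c : ℝ) * 2 ^ (1 - 2 * ρ) * L ^ (1 - 2 * ρ)) := by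
          rw [Real.mul_rpow two_pos.le hL0.le, ← ENNReal.ofReal_coe_nnreal,
            ← ENNReal.ofReal_mul (NNReal.coe_nonneg c)]
          congr 1
          ring
  have hE0 : 0 ≤ (1 - ρ) / (2 + ρ) * (c : ℝ) := by positivity
  have hbE : ∀ L : ℝ, 1 ≤ L →
      ∫⁻ z in closedBall (0 : EuclideanSpace ℝ (Fin 3)) L, ‖fderiv ℝ V z‖ₑ ^ 2 ≤
        ENNReal.ofReal ((1 - ρ) / (2 + ρ) * (c : ℝ) * L ^ (1 - ρ)) :=
    fun L hL => NeedleRace.lintegral_fderiv_sq_closedBall_le hρ1' hE0 hE' hL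
  -- ### strong thin exits with the EXPLICIT rate `β₀`
  have hcA0 : 0 ≤ (c : ℝ) * 2 ^ (1 - 2 * ρ) := by positivity
  obtain ⟨β₀, hβ₀def⟩ : ∃ β₀ : ℝ, β₀ = (min 1 ((1 / (2 + ρ)) ^ 2 / (614400 * (NeedleBandLaw.bandConst + 1) * (2 * ((c : ℝ) * 2 ^ (1 - 2 * ρ)) + 2 * ((1 - ρ) / (2 + ρ) * (c : ℝ)) + 2))) / 4) := ⟨_, rfl⟩
  have hβ : 0 < β₀ := by
    rw [hβ₀def]
    have hK := NeedleBandLaw.bandConst_nonneg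
    have h2 : 0 ≤ (1 - ρ) / (2 + ρ) * (c : ℝ) := by positivity
    have h3 : 0 < 2 * ((c : ℝ) * 2 ^ (1 - 2 * ρ)) + 2 * ((1 - ρ) / (2 + ρ) * (c : ℝ)) + 2 := by linarith
    positivity
  have hthinS : ∀ R : ℝ, 1 ≤ R →
      ∃ (G : Set ℝ) (N : Set (EuclideanSpace ℝ (Fin 3))), MeasurableSet G ∧ G ⊆ Icc (R ^ 2) ((2 * R) ^ 2) ∧
        1 * R ^ 2 ≤ (volume G).toReal ∧ MeasurableSet N ∧ N ⊆ closedBall (0 : EuclideanSpace ℝ (Fin 3)) (2 * R) ∧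
        (∀ z : EuclideanSpace ℝ (Fin 3), ‖z‖ ^ 2 ∈ G → ⟪V z, z⟫ + (1 / (2 + ρ)) * ‖z‖ ^ 2 < 0 → z ∈ N) ∧
        volume N * ∫⁻ z in N, ENNReal.ofReal (‖V z‖ ^ 2) ≤
          ENNReal.ofReal (((c : ℝ) * 2 ^ (1 - 2 * ρ) + 1) * (192 + 9216 * (2 * ((c : ℝ) * 2 ^ (1 - 2 * ρ)) + 1) / (1 / (2 + ρ)) ^ 2) *
            R ^ (4 : ℝ) * Real.exp (-(β₀ * R ^ (2 + ρ)))) := by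
    intro R hR
    have h := NeedleFastSetMeasure.thinFastExits_strong (hV.of_le (by norm_num)) hγ hρ.le hρ1 hcA0 hE0 hbA hbE hR
    simpa only [hβ₀def] using h
  -- ### the clock strength `c′ = β₀/(12γ)`: `6γc′ = β₀/2 < β₀`, and `κ_sp = (1−2γ)w₀²c′/2`
  obtain ⟨c', hc'⟩ : ∃ c' : ℝ, c' = β₀ / (12 * (1 / (2 + ρ))) := ⟨_, rfl⟩
  have hc'0 : 0 < c' := by rw [hc']; positivity
  have hβc : 6 * (1 / (2 + ρ)) * c' < β₀ := by
    rw [hc']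
    field_simp
    nlinarith [hβ, h2ρ]
  have hCle : C ≤ (1 - 2 * (1 / (2 + ρ))) * w₀ ^ 2 * (c' / 2) := by
    rw [← hβ₀def] at hCκ
    have e : (1 - 2 * (1 / (2 + ρ))) * w₀ ^ 2 * (c' / 2) = (1 - 2 * (1 / (2 + ρ))) * w₀ ^ 2 * β₀ / (24 * (1 / (2 + ρ))) := by
      rw [hc']
      field_simp
      ring
    rw [e]; exact hCκ.le
  -- ### the clock at strength `c′`, and «one clocked ball kills»
  obtain ⟨x₁, r, hr, R₀, hR₀⟩ := LastExit.powerClockAt_of_criticalSpikes ρ hρ hρ1 V P' hV hprof h w₀ R₁ hw₀ hNFH C c' hc'0 hCle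
    hNS x₀ hx₀ hhx₀
  exact (NeedleRace.false_of_powerClockAt_of_strongThinExits (γ := 1 / (2 + ρ)) (e := 2 + ρ) hV hdiv hγ one_pos
    (by linarith) (by positivity) hthinS hc'0.le hβc hr hR₀).elim

end Summit.NavierStokesRegularity.NavierStokesRegularity.Theorems.PowerGaugeEulerLiouville

end
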